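import Summits.ResolutionOfSingularities.ResolutionOfSingularities.Theorems.FrobeniusLadderFRationalResolutionHomogeneousUnits
import Mathlib.RingTheory.Smooth.Fiber
import Mathlib.RingTheory.Kaehler.Basic
import Mathlib.LinearAlgebra.FreeModule.Finite.Basic
import Mathlib.RingTheory.Finiteness.ModuleFinitePresentation
import Mathlib.GroupTheory.OrderOfElement
import Mathlib.RingTheory.Flat.FaithfullyFlat.Basic
import HarnessLib

/-!
# Crux `FrobeniusLadder.FRationalResolution` (stmt-ResolutionOfSingularities-15317), line `redirect`,
# stub `stub_diagonalizableQuotientResolution` — census item R3-tame: an algebra with a basis of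
# UNITS indexed by a finite abelian group `B`, multiplicative up to scalars, is FINITE ÉTALE as soon
# as `|B|` is invertible (Kummer étaleness of the `D(B)`-torsor `Spec S^{(B_𝔔)} → Spec S₀`)

Census item R3-tame of the repair census for `stub_diagonalizableQuotientResolution` (leafhand-3 g0,
ladder-directors/REQUESTS.md 2026-08-31T08:23:36Z): after coarsening the grading of the regular
chart ring `S` by the unit-degree subgroup `B = B_𝔔` of a point (`…StabilizerSubgroup`,
`…Coarsening`) and inverting an element of `S₀ ∖ 𝔮`, the intermediate ring `S^{(B)} = ⊕_{b ∈ B} S_b`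
is graded by `B` with a homogeneous UNIT `u_b` in every degree, hence free over `S₀` on `(u_b)_b`
(`…HomogeneousUnits`, `…LocalizedUnitsBasis`). This file proves the TAME conclusion: when `|B|` is
invertible the torsor is finite étale, so that `Spec S^{(B)}` is again an étale chart of `X` — one
through a FIXED point of the coarsened grading.

Graded-free form (any `R`-algebra `T` with a basis of units `u : B → T`, `u_b u_{b'} ∈ R · u_{b+b'}`):

* `exists_zero_eq_algebraMap`, `exists_pow_eq_algebraMap_mul`, `exists_pow_addOrderOf_eq_algebraMap`
  — `u_0 ∈ R`, `u_b^n ∈ R · u_{nb}`, `u_b^{ord b} ∈ R`;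
* `derivation_apply_eq_zero` — every `R`-derivation kills `u_b` when `ord b` is invertible
  (`0 = D(u_b^{n}) = n u_b^{n-1} D u_b`);
* `subsingleton_kaehlerDifferential`, `formallyUnramified` — `Ω_{T/R} = 0` when `|B| ∈ T^×`;
* `etale` — **`T` is étale over `R`** (free of finite rank ⇒ flat and finitely presented;
  `Algebra.Etale.of_formallyUnramified_of_flat`); `finrank_eq_natCard`, `faithfullyFlat`.

Graded form (`GradedAlgebra 𝒯`, `𝒯 : B → Submodule k T`, a homogeneous unit in every degree):

* `GradedUnits.etale` — **`T` is étale over `T₀ = 𝒯 0`** when `|B| ∈ T^×`; with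
  `GradedUnits.finite`, `GradedUnits.free`, `GradedUnits.formallyUnramified`.

Honest label: brick R3-tame (no stub closed; the scheme-level repackaging of the chart is not
here). No definitions, no named facts, no sorry. [folklore; cite: SGA3, Exp. VIII §4–5;
SGA1, Exp. I Prop. 7.6 (Kummer étale algebras)]
-/

noncomputable section

-- single-problem summit: the doubled namespace component is forced
set_option linter.dupNamespace false

open DirectSum

namespace Summit.ResolutionOfSingularities.ResolutionOfSingularities.Theorems.FRationalResolution.UnitBasisEtale

universe u v w

section GradedFree

variable {R : Type u} {T : Type v} [CommRing R] [CommRing T] [Algebra R T]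
  {B : Type w} [AddCommGroup B] (u : B → T) (hunit : ∀ b, IsUnit (u b))
  (hmul : ∀ b b', ∃ r : R, u b * u b' = r • u (b + b'))
include hunit hmul

/-- **`u_0` is a scalar**: from `u_0 u_0 = r u_0` and `u_0` a unit, `u_0 = r · 1`. [folklore] -/
theorem exists_zero_eq_algebraMap : ∃ r : R, u 0 = algebraMap R T r := by
  obtain ⟨r, hr⟩ := hmul 0 0
  rw [add_zero] at hr
  refine ⟨r, (hunit 0).mul_left_cancel ?_⟩
  rw [hr, Algebra.smul_def, mul_comm]

omit hunit in
/-- **`u_b^n ∈ R · u_{nb}`** for `n ≥ 1` (induction on the multiplicativity up to scalars).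
[folklore] -/
theorem exists_pow_eq_algebraMap_mul (b : B) :
    ∀ n : ℕ, 0 < n → ∃ r : R, u b ^ n = algebraMap R T r * u (n • b) := by
  intro n hn
  induction n with
  | zero => exact absurd hn (lt_irrefl 0)
  | succ n ih =>
    rcases Nat.eq_zero_or_pos n with rfl | hpos
    · exact ⟨1, by simp⟩
    · obtain ⟨r, hr⟩ := ih hpos
      obtain ⟨r', hr'⟩ := hmul (n • b) b
      refine ⟨r * r', ?_⟩
      rw [pow_succ, hr, mul_assoc, hr', Algebra.smul_def, ← mul_assoc, ← map_mul, succ_nsmul]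

/-- **`u_b^{ord b}` is a scalar** (for `b` of finite order). [folklore] -/
theorem exists_pow_addOrderOf_eq_algebraMap (b : B) (hb : IsOfFinAddOrder b) :
    ∃ r : R, u b ^ addOrderOf b = algebraMap R T r := by
  obtain ⟨r, hr⟩ := exists_pow_eq_algebraMap_mul u hmul b (addOrderOf b) hb.addOrderOf_pos
  obtain ⟨r₀, hr₀⟩ := exists_zero_eq_algebraMap u hunit hmul
  refine ⟨r * r₀, ?_⟩
  rw [hr, addOrderOf_nsmul_eq_zero, hr₀, ← map_mul]

/-- **Every `R`-derivation kills a unit of the basis whose degree has invertible order**: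
`0 = D(u_b^n) = n u_b^{n-1} D(u_b)` with `n u_b^{n-1}` a unit. [folklore; cite: SGA1, Exp. I
Prop. 7.6] -/
theorem derivation_apply_eq_zero {M : Type*} [AddCommGroup M] [Module T M] [Module R M]
    [IsScalarTower R T M] (D : Derivation R T M) (b : B) (hb : IsOfFinAddOrder b)
    (hn : IsUnit ((addOrderOf b : ℕ) : T)) : D (u b) = 0 := by
  obtain ⟨r, hr⟩ := exists_pow_addOrderOf_eq_algebraMap u hunit hmul b hb
  have h := D.leibniz_pow (u b) (addOrderOf b)
  rw [hr, D.map_algebraMap, ← Nat.cast_smul_eq_nsmul T, smul_smul] at h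
  have hu : IsUnit (((addOrderOf b : ℕ) : T) * u b ^ (addOrderOf b - 1)) :=
    hn.mul ((hunit b).pow _)
  exact (hu.smul_eq_zero).mp h.symm

variable [Finite B]

/-- **`Ω_{T/R} = 0`** when `T` has an `R`-basis of units `(u_b)_{b ∈ B}`, multiplicative up to
scalars, with `|B|` invertible in `T`: every `D(u_b)` vanishes and the `u_b` span.
[folklore; cite: SGA1, Exp. I Prop. 7.6] -/
theorem subsingleton_kaehlerDifferential (basis : Module.Basis B R T) (hbu : ∀ b, basis b = u b)
    (hcard : IsUnit ((Nat.card B : ℕ) : T)) : Subsingleton (Ω[T⁄R]) := by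
  classical
  haveI : Fintype B := Fintype.ofFinite B
  -- every `D x` vanishes
  have hD : ∀ x : T, KaehlerDifferential.D R T x = 0 := by
    intro x
    have hx : x = ∑ b, basis.repr x b • u b := by
      conv_lhs => rw [← basis.sum_repr x]
      simp only [hbu]
    rw [hx, map_sum]
    refine Finset.sum_eq_zero fun b _ => ?_
    rw [Derivation.map_smul_of_tower]
    have hb : IsOfFinAddOrder b := isOfFinAddOrder_of_finite b
    have hn : IsUnit ((addOrderOf b : ℕ) : T) := by
      obtain ⟨m, hm⟩ := addOrderOf_dvd_natCard b
      rw [hm, Nat.cast_mul] at hcard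
      exact isUnit_of_mul_isUnit_left hcard
    rw [derivation_apply_eq_zero u hunit hmul _ b hb hn, smul_zero]
  refine ⟨fun x y => ?_⟩
  have hmem : ∀ z : Ω[T⁄R], z = 0 := by
    intro z
    have hz : z ∈ Submodule.span T (Set.range (KaehlerDifferential.D R T)) := by
      rw [KaehlerDifferential.span_range_derivation]; trivial
    have hle : Submodule.span T (Set.range (KaehlerDifferential.D R T)) ≤ ⊥ := by
      rw [Submodule.span_le]
      rintro _ ⟨t, rfl⟩
      simp [hD t]
    simpa using hle hz
  rw [hmem x, hmem y]

/-- **Formally unramified.** [folklore; cite: SGA1, Exp. I Prop. 7.6] -/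
theorem formallyUnramified (basis : Module.Basis B R T) (hbu : ∀ b, basis b = u b)
    (hcard : IsUnit ((Nat.card B : ℕ) : T)) : Algebra.FormallyUnramified R T :=
  ⟨subsingleton_kaehlerDifferential u hunit hmul basis hbu hcard⟩

/-- **Kummer étaleness.** An `R`-algebra `T` with a basis of units `(u_b)_{b ∈ B}` indexed by a
finite abelian group, multiplicative up to scalars (`u_b u_{b'} ∈ R · u_{b+b'}`), with `|B|`
invertible in `T`, is ÉTALE over `R` (free of finite rank ⇒ flat and finitely presented; formally
unramified by `formallyUnramified`). [folklore; cite: SGA1, Exp. I Prop. 7.6; SGA3, Exp. VIII §4–5] -/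
theorem etale (basis : Module.Basis B R T) (hbu : ∀ b, basis b = u b)
    (hcard : IsUnit ((Nat.card B : ℕ) : T)) : Algebra.Etale R T := by
  haveI : Module.Free R T := Module.Free.of_basis basis
  haveI : Fintype B := Fintype.ofFinite B
  haveI : Module.Finite R T := Module.Finite.of_basis basis
  haveI : Module.FinitePresentation R T := Module.finitePresentation_of_projective R T
  haveI : Algebra.FormallyUnramified R T := formallyUnramified u hunit hmul basis hbu hcard
  exact Algebra.Etale.of_formallyUnramified_of_flat

omit hunit hmul [AddCommGroup B] in
/-- The rank is `|B|`. [folklore] -/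
theorem finrank_eq_natCard (basis : Module.Basis B R T) [StrongRankCondition R] :
    Module.finrank R T = Nat.card B := by
  haveI : Fintype B := Fintype.ofFinite B
  rw [Module.finrank_eq_card_basis basis, Nat.card_eq_fintype_card]

omit hunit hmul [AddCommGroup B] [Finite B] in
/-- Free on the basis, hence faithfully flat when `T ≠ 0`. [folklore] -/
theorem faithfullyFlat (basis : Module.Basis B R T) [Nontrivial T] : Module.FaithfullyFlat R T := by
  haveI : Module.Free R T := Module.Free.of_basis basis
  infer_instance

end GradedFree

/-! ### Graded form: a homogeneous unit in every degree -/

section Graded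

variable {k : Type u} [CommRing k] {B : Type w} [DecidableEq B] [AddCommGroup B] {T : Type v}
  [CommRing T] [Algebra k T] (𝒯 : B → Submodule k T) [GradedAlgebra 𝒯]
  (hunits : ∀ b, ∃ u ∈ 𝒯 b, IsUnit u)
include hunits

/-- Normalised system of homogeneous units: `u_0 = 1`, `u_b ∈ T_b` a unit, together with the
basis of `T` over `T_0` it forms (`HomogeneousUnits.exists_basis_of_homogeneous_units`) and the
multiplicativity up to degree-`0` scalars. [folklore; cite: SGA3, Exp. VIII §4–5] -/
theorem GradedUnits.exists_normalised_basis :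
    ∃ (u : B → T) (basis : Module.Basis B (𝒯 0) T), u 0 = 1 ∧ (∀ b, u b ∈ 𝒯 b) ∧
      (∀ b, IsUnit (u b)) ∧ (∀ b, basis b = u b) ∧
      ∀ b b', ∃ r : 𝒯 0, u b * u b' = r • u (b + b') := by
  classical
  choose v hv hvunit using hunits
  let u : B → T := Function.update v 0 1
  have hu0 : u 0 = 1 := Function.update_self ..
  have hu : ∀ b, u b ∈ 𝒯 b := by
    intro b
    by_cases hb : b = 0
    · subst hb; rw [hu0]; exact SetLike.one_mem_graded 𝒯
    · simp only [u, Function.update_of_ne hb]; exact hv b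
  have hunit : ∀ b, IsUnit (u b) := by
    intro b
    by_cases hb : b = 0
    · subst hb; rw [hu0]; exact isUnit_one
    · simp only [u, Function.update_of_ne hb]; exact hvunit b
  obtain ⟨basis, hbasis⟩ := HomogeneousUnits.exists_basis_of_homogeneous_units 𝒯 u hu hunit
  refine ⟨u, basis, hu0, hu, hunit, hbasis, fun b b' => ?_⟩
  obtain ⟨w, hw⟩ := (hunit (b + b')).exists_right_inv
  obtain ⟨r, hr, hrw⟩ := (HomogeneousUnits.mem_grade_iff_exists_mul_unit 𝒯 (hu (b + b')) hw
    (u b * u b')).mp (SetLike.mul_mem_graded (hu b) (hu b'))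
  exact ⟨⟨r, hr⟩, by rw [hrw, Algebra.smul_def]; rfl⟩

/-- **`T` is free over `T_0`.** [folklore; cite: SGA3, Exp. VIII §4–5] -/
theorem GradedUnits.free : Module.Free (𝒯 0) T := by
  obtain ⟨_, basis, -⟩ := GradedUnits.exists_normalised_basis 𝒯 hunits
  exact Module.Free.of_basis basis

/-- **`T` is finite over `T_0`** (finite grading group). [folklore; cite: SGA3, Exp. VIII §4–5] -/
theorem GradedUnits.finite [Finite B] : Module.Finite (𝒯 0) T := by
  haveI : Fintype B := Fintype.ofFinite B
  obtain ⟨_, basis, -⟩ := GradedUnits.exists_normalised_basis 𝒯 hunits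
  exact Module.Finite.of_basis basis

/-- **`T` is formally unramified over `T_0`** when `|B|` is invertible.
[folklore; cite: SGA1, Exp. I Prop. 7.6] -/
theorem GradedUnits.formallyUnramified [Finite B] (hcard : IsUnit ((Nat.card B : ℕ) : T)) :
    Algebra.FormallyUnramified (𝒯 0) T := by
  obtain ⟨u, basis, -, -, hunit, hbasis, hmul⟩ := GradedUnits.exists_normalised_basis 𝒯 hunits
  exact UnitBasisEtale.formallyUnramified u hunit hmul basis hbasis hcard

/-- **Kummer étaleness, graded form.** A `B`-graded algebra (`B` a finite abelian group) with a
homogeneous unit in every degree and `|B|` invertible is ÉTALE over its degree-zero part: the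
tame `D(B)`-torsor `Spec T → Spec T_0` is finite étale. [folklore; cite: SGA1, Exp. I Prop. 7.6;
SGA3, Exp. VIII §4–5] -/
theorem GradedUnits.etale [Finite B] (hcard : IsUnit ((Nat.card B : ℕ) : T)) :
    Algebra.Etale (𝒯 0) T := by
  obtain ⟨u, basis, -, -, hunit, hbasis, hmul⟩ := GradedUnits.exists_normalised_basis 𝒯 hunits
  exact UnitBasisEtale.etale u hunit hmul basis hbasis hcard

end Graded

end Summit.ResolutionOfSingularities.ResolutionOfSingularities.Theorems.FRationalResolution.UnitBasisEtale

end
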